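import Mathlib.NumberTheory.LocalField.Basic
import Mathlib.Topology.Algebra.ContinuousMonoidHom
import Mathlib.MeasureTheory.Measure.Haar.Unique
import Mathlib.LinearAlgebra.Matrix.Trace
import Mathlib.LinearAlgebra.Matrix.Notation
import Mathlib.Tactic.FinCases
import Mathlib.Tactic.LinearCombination
import HarnessLib

/-!
# F0 · P3c · line LH6 «StCharTS» — ROAD «HC-D» brick (CO) «REAL-FORM COORDINATES», FILE 1: explicit `F′`-coordinates
# `Φ : (Fin 9 → F′) ≃ₜ+ ↥𝔲`, `Φ₀ : (Fin 8 → F′) ≃ₜ+ ↥𝔲₀` of the Lie algebra `𝔲 = 𝔲(σ, Φ₃)(K)` of the quasi-split unitary group and of its trace-zero part,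
# their `F′`-scaling equivariance, and the transport of Haar measure

Cell `pub/hodgecm-mathlib`, crux H413 = `stmt-HodgeConjecture-24833` (lane `--supports … --as helper`), route HCCMUnconditional; seat F0P2-p06 (g18), brick (CO) of
the road «HC-D» of F0P2-p01 (g23) (deal: bus F0∕P2 2026-09-02T16:29:10Z «R3♭ (3)»; rulings R1–R5 16:24:15Z: SCALAR-FREE currency `≃ₜ+`, ARBITRARY carriers with
membership hypotheses, no `Module F` structure).  THEOREMS ONLY (no definition ∕ instance ∕ notation ∕ named fact ∕ `sorry`); Mathlib only.

SETTING.  `K` a topological field with an involution `σ` (`hσ`), `2 ∈ Kˣ`; `F′` a topological field with a CLOSED EMBEDDING `ι : F′ →+* K` whose image is the fixed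
field of `σ` (`hιr : σ x = x ↔ x ∈ range ι`); a SKEW unit `lam` (`σ lam = −lam`), so that `K = ι F′ ⊕ lam·ι F′`; the antidiagonal form `J = Φ₃ = !![0,0,1;0,1,0;1,0,0]`
(`hJ`; = ★ `(StdForm.antidiagonal 3).over K` entrywise by ★ `StdForm.antidiagonal_over_apply` — `antidiagonal_eq_of_apply_rev` below docks the `Fin.rev` spelling); the
Lie algebra as an ARBITRARY additive subgroup `𝔲 ≤ M₃(K)` with `h𝔲 : X ∈ 𝔲 ↔ (X.map σ)ᵀ * J + J * X = 0`, its trace-zero part `𝔲₀` with `h𝔲₀ : … ∧ trace X = 0`.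
In the model: `K = L_w`, `F′ = L⁺_v`, `ι = algebraMap`, `σ` = the conjugation of `L_w ∕ L⁺_v`, `v` non-split.

INDEX BOOKKEEPING (§1 `lie_eq_iff`): `(X.map σ)ᵀ Φ₃ + Φ₃ X = 0 ⟺ X_{ij} = −σ X_{2−j,2−i}` for all `i, j`: the entries pair up as `{X₀₀, X₂₂}`, `{X₀₁, X₁₂}`, `{X₁₀, X₂₁}`
(each pair = one free element of `K` = two `F′`-coordinates `ι a + lam·ι b`, partner `−ι a + lam·ι b`) and the three antidiagonal entries `X₀₂, X₁₁, X₂₀` are SKEW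
(`σ s = −s`, one `F′`-coordinate `lam·ι c` each): `9` coordinates.  `trace X = 2·lam·ι b₀₀ + X₁₁`, so on `𝔲₀` the coordinate of `X₁₁` is dropped
(`X₁₁ = −2·lam·ι(a 1)`): `8` coordinates.  The INVERSE charts read the coordinates WITHOUT `σ` — fixed parts `(X₀₀ − X₂₂)∕2`, skew parts `(X₀₀ + X₂₂)∕(2·lam)`,
`X₀₂∕lam`, … — through a continuous left inverse of `ι` on `range ι` (§0), so no continuity of `σ` is assumed.

* §0 `exists_continuousOn_leftInverse` — a closed embedding of fields has a left inverse continuous on its range; `antidiagonal_eq_of_apply_rev` (docking of `J`).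
* §1 `lie_eq_iff` — the defining equation entrywise; the PAIR∕SKEW coordinate algebra (`pair_*`, `skew_*`).
* §2 **`exists_coords_lie`** — `Φ : (Fin 9 → F′) ≃ₜ+ ↥𝔲` with its nine ENTRY LETTERS and the scaling equivariance `Φ (l • a) = ι l • Φ a` (on matrices).
* (sequel `…HCDCoordinatesTraceZero`, same seat) §3 `exists_coords_lie_traceZero` — `Φ₀ : (Fin 8 → F′) ≃ₜ+ ↥𝔲₀`; §4 HAAR transport (`isAddHaarMeasure_map_coords`,
  `exists_map_coords_eq_smul`).  Split off for the 400-line rule.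
Consumers: D3v «VERTEX ENGINE» (LH10-p01), D5(iv)+GLOBAL (F0P3a-p07), D3b∕c docking (F0P3b-p01), D5(iii) — every `Fin n → F′` statement (`Measure.pi`, `≃L[F′]`
trivialisations, dilations) is moved onto `↥𝔲₀` through `Φ₀` and its letters.  FILE 2 (`…HCDCoordinatesSlice`) adds the Slodowy-slice and Chevalley-target charts.
HONEST LABEL: HC_CM is proved only modulo the 7 printed citations (2 remaining named inputs: hLiu418 = `stmt-HodgeConjecture-24832`, h413 = `stmt-HodgeConjecture-24833`)
until rung 0 closes; this file closes no organ (count-neutral plumbing for the (HC-D) named input `hDGliO` of ★ RUNG0).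

## References
* [Rogawski1990] J. D. Rogawski, *Automorphic Representations of Unitary Groups in Three Variables*, Ann. of Math. Stud. 123 (1990), §4.9 p. 54, §12.5 p. 182 (the
  quasi-split unitary group `U(Φ₃)` of a quadratic extension and its Lie algebra; context for the coordinates).
* [PlatonovRapinchuk1994] V. Platonov, A. Rapinchuk, *Algebraic Groups and Number Theory* (1994), §2.3.3 (unitary groups of hermitian forms over quadratic
  extensions; restriction of scalars), §3.3.
* [HarishChandra1970] Harish-Chandra, *Harmonic analysis on reductive p-adic groups*, LNM 162 (1970), Part VII §1 Thm. 15 (the named input (HC-D) this road pays).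
-/

set_option autoImplicit false
-- the mandated namespace has the single-problem summit's repeated segment (`HodgeConjecture.HodgeConjecture`)
set_option linter.dupNamespace false

open Matrix Topology MeasureTheory
open scoped ENNReal

namespace Summit.HodgeConjecture.HodgeConjecture.Cruxes.H413.F0P3cStCharTSHCDCoordinates

/-! ## §0 Generic plumbing: a continuous left inverse of a closed embedding; the antidiagonal form -/

section LeftInverse

variable {K : Type*} [Field K] [TopologicalSpace K] {F' : Type*} [Field F'] [TopologicalSpace F']

/-- **A closed embedding of fields has a left inverse which is continuous on its range** (the inverse homeomorphism `range ι ≃ₜ F′` extended arbitrarily).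
[cite: PlatonovRapinchuk1994, §3.3] -/
theorem exists_continuousOn_leftInverse (ι : F' →+* K) (hι : IsClosedEmbedding ι) :
    ∃ g : K → F', (∀ a, g (ι a) = a) ∧ ContinuousOn g (Set.range ι) := by
  classical
  haveI : Nonempty F' := ⟨0⟩
  refine ⟨Function.invFun ι, Function.leftInverse_invFun hι.injective, ?_⟩
  rw [continuousOn_iff_continuous_restrict]
  have heq : (Set.range (ι : F' → K)).restrict (Function.invFun ι) = fun y => hι.isEmbedding.toHomeomorph.symm y := by
    funext y
    obtain ⟨x, hx⟩ := y.2
    have hy : y = ⟨ι x, ⟨x, rfl⟩⟩ := Subtype.ext hx.symm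
    rw [hy, Set.restrict_apply, Function.leftInverse_invFun hι.injective x, IsEmbedding.toHomeomorph_symm_apply]
  rw [heq]
  exact hι.isEmbedding.toHomeomorph.symm.continuous

/-- Docking of the form: a matrix with entries `[j = rev i]` IS `!![0,0,1;0,1,0;1,0,0]` (★ `StdForm.antidiagonal_over_apply` spelling ↦ this file's).
[cite: Rogawski1990, §4.9 p. 54] -/
theorem antidiagonal_eq_of_apply_rev {R : Type*} [Ring R] {J : Matrix (Fin 3) (Fin 3) R} (hJ : ∀ i j, J i j = if j = i.rev then 1 else 0) :
    J = !![0, 0, 1; 0, 1, 0; 1, 0, 0] := by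
  ext i j
  rw [hJ]
  fin_cases i <;> fin_cases j <;> rfl

end LeftInverse

/-! ## §1 The defining equation entrywise; pair ∕ skew coordinate algebra -/

section Algebra

variable {K : Type*} [Field K] (σ : K →+* K)

/-- **`(X.map σ)ᵀ Φ₃ + Φ₃ X = 0` entrywise**: entry `(i, j)` of the left side is `σ X_{2−j, i} + X_{2−i, j}`. [cite: Rogawski1990, §4.9 p. 54] -/
theorem lie_eq_iff (X : Matrix (Fin 3) (Fin 3) K) :
    (X.map σ)ᵀ * !![(0 : K), 0, 1; 0, 1, 0; 1, 0, 0] + !![(0 : K), 0, 1; 0, 1, 0; 1, 0, 0] * X = 0 ↔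
      (σ (X 2 0) + X 2 0 = 0 ∧ σ (X 1 0) + X 2 1 = 0 ∧ σ (X 0 0) + X 2 2 = 0) ∧
      (σ (X 2 1) + X 1 0 = 0 ∧ σ (X 1 1) + X 1 1 = 0 ∧ σ (X 0 1) + X 1 2 = 0) ∧
      (σ (X 2 2) + X 0 0 = 0 ∧ σ (X 1 2) + X 0 1 = 0 ∧ σ (X 0 2) + X 0 2 = 0) := by
  rw [← Matrix.ext_iff]
  simp only [Fin.forall_fin_succ, Matrix.add_apply, Matrix.mul_apply, Matrix.transpose_apply, Matrix.map_apply,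
    Fin.sum_univ_three, Matrix.zero_apply]
  simp [Fin.succ_zero_eq_one, Fin.succ_one_eq_two]


/-- `σ (lam⁻¹) = −lam⁻¹`. [cite: PlatonovRapinchuk1994, §2.3.3] -/
theorem map_units_inv_eq_neg (lam : Kˣ) (hlam : σ lam = -lam) : σ ((lam⁻¹ : Kˣ) : K) = -((lam⁻¹ : Kˣ) : K) := by
  have h1 : σ ((lam⁻¹ : Kˣ) : K) * σ (lam : K) = 1 := by rw [← map_mul, Units.inv_mul, map_one]
  rw [hlam, mul_neg, neg_eq_iff_eq_neg] at h1
  have : σ ((lam⁻¹ : Kˣ) : K) = σ ((lam⁻¹ : Kˣ) : K) * (lam : K) * ((lam⁻¹ : Kˣ) : K) := by rw [Units.mul_inv_cancel_right]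
  rw [this, h1, neg_mul, one_mul]

/-- PAIR, forward: the fixed part of `(ι a + lam·ι b, −ι a + lam·ι b)` is `ι a`. [cite: PlatonovRapinchuk1994, §2.3.3] -/
theorem pair_fst [Invertible (2 : K)] (lam : Kˣ) (p q : K) : (p + (lam : K) * q - (-p + (lam : K) * q)) * ⅟(2 : K) = p := by
  have h2 : (2 : K) * ⅟(2 : K) = 1 := mul_invOf_self 2
  linear_combination p * h2

/-- PAIR, forward: the skew coordinate of `(ι a + lam·ι b, −ι a + lam·ι b)` is `ι b`. [cite: PlatonovRapinchuk1994, §2.3.3] -/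
theorem pair_snd [Invertible (2 : K)] (lam : Kˣ) (p q : K) : (p + (lam : K) * q + (-p + (lam : K) * q)) * ⅟(2 : K) * ((lam⁻¹ : Kˣ) : K) = q := by
  have h2 : (2 : K) * ⅟(2 : K) = 1 := mul_invOf_self 2
  have hl : (lam : K) * ((lam⁻¹ : Kˣ) : K) = 1 := Units.mul_inv lam
  linear_combination (q * ((lam : K) * ((lam⁻¹ : Kˣ) : K))) * h2 + q * hl

/-- SKEW, forward: the coordinate of `lam·ι c` is `ι c`. [cite: PlatonovRapinchuk1994, §2.3.3] -/
theorem skew_coord (lam : Kˣ) (q : K) : (lam : K) * q * ((lam⁻¹ : Kˣ) : K) = q := by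
  rw [mul_comm (lam : K) q, Units.mul_inv_cancel_right]

/-- PAIR, backward: `(x − y)∕2 + lam·((x + y)∕(2·lam)) = x`. [cite: PlatonovRapinchuk1994, §2.3.3] -/
theorem pair_recombine_fst [Invertible (2 : K)] (lam : Kˣ) (x y : K) : (x - y) * ⅟(2 : K) + (lam : K) * ((x + y) * ⅟(2 : K) * ((lam⁻¹ : Kˣ) : K)) = x := by
  have h2 : (2 : K) * ⅟(2 : K) = 1 := mul_invOf_self 2
  have hl : (lam : K) * ((lam⁻¹ : Kˣ) : K) = 1 := Units.mul_inv lam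
  linear_combination x * h2 + ((x + y) * ⅟(2 : K)) * hl

/-- PAIR, backward: `−(x − y)∕2 + lam·((x + y)∕(2·lam)) = y`. [cite: PlatonovRapinchuk1994, §2.3.3] -/
theorem pair_recombine_snd [Invertible (2 : K)] (lam : Kˣ) (x y : K) : -((x - y) * ⅟(2 : K)) + (lam : K) * ((x + y) * ⅟(2 : K) * ((lam⁻¹ : Kˣ) : K)) = y := by
  have h2 : (2 : K) * ⅟(2 : K) = 1 := mul_invOf_self 2
  have hl : (lam : K) * ((lam⁻¹ : Kˣ) : K) = 1 := Units.mul_inv lam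
  linear_combination y * h2 + ((x + y) * ⅟(2 : K)) * hl

/-- SKEW, backward: `lam·(s∕lam) = s`. [cite: PlatonovRapinchuk1994, §2.3.3] -/
theorem skew_recombine (lam : Kˣ) (s : K) : (lam : K) * (s * ((lam⁻¹ : Kˣ) : K)) = s := by
  rw [mul_comm s, ← mul_assoc, Units.mul_inv, one_mul]

/-- PAIR, fixedness: if `σ x + y = 0` then `(x − y)∕2` is `σ`-fixed. [cite: PlatonovRapinchuk1994, §2.3.3] -/
theorem pair_fst_fixed (hσ : ∀ x, σ (σ x) = x) [Invertible (2 : K)] {x y : K} (h : σ x + y = 0) :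
    σ ((x - y) * ⅟(2 : K)) = (x - y) * ⅟(2 : K) := by
  have hy : y = -σ x := by linear_combination h
  have hx : σ y = -x := by rw [hy, map_neg, hσ]
  -- `σ ⅟2 = ⅟2` (★ `DoubledUnitary.map_invOf_two'`, re-derived inline to keep the imports Mathlib-only)
  have h2 : σ (⅟(2 : K)) = ⅟(2 : K) := by
    have h : σ (⅟(2 : K)) * 2 = 1 := by
      have := congrArg σ (invOf_mul_self (2 : K))
      rwa [map_mul, map_ofNat, map_one] at this
    calc σ (⅟(2 : K)) = σ (⅟(2 : K)) * 2 * ⅟(2 : K) := by rw [mul_invOf_cancel_right]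
      _ = ⅟(2 : K) := by rw [h, one_mul]
  rw [map_mul, map_sub, h2, hx, hy]
  ring

/-- PAIR, fixedness: if `σ x + y = 0` then `(x + y)∕(2·lam)` is `σ`-fixed. [cite: PlatonovRapinchuk1994, §2.3.3] -/
theorem pair_snd_fixed (hσ : ∀ x, σ (σ x) = x) [Invertible (2 : K)] (lam : Kˣ) (hlam : σ lam = -lam) {x y : K} (h : σ x + y = 0) :
    σ ((x + y) * ⅟(2 : K) * ((lam⁻¹ : Kˣ) : K)) = (x + y) * ⅟(2 : K) * ((lam⁻¹ : Kˣ) : K) := by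
  have hy : y = -σ x := by linear_combination h
  have hx : σ y = -x := by rw [hy, map_neg, hσ]
  have h2 : σ (⅟(2 : K)) = ⅟(2 : K) := by
    have h : σ (⅟(2 : K)) * 2 = 1 := by
      have := congrArg σ (invOf_mul_self (2 : K))
      rwa [map_mul, map_ofNat, map_one] at this
    calc σ (⅟(2 : K)) = σ (⅟(2 : K)) * 2 * ⅟(2 : K) := by rw [mul_invOf_cancel_right]
      _ = ⅟(2 : K) := by rw [h, one_mul]
  rw [map_mul, map_mul, map_add, h2, map_units_inv_eq_neg σ lam hlam, hx, hy]
  ring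

/-- SKEW, fixedness: if `σ s + s = 0` then `s∕lam` is `σ`-fixed. [cite: PlatonovRapinchuk1994, §2.3.3] -/
theorem skew_fixed (lam : Kˣ) (hlam : σ lam = -lam) {s : K} (h : σ s + s = 0) : σ (s * ((lam⁻¹ : Kˣ) : K)) = s * ((lam⁻¹ : Kˣ) : K) := by
  have hs : σ s = -s := by linear_combination h
  rw [map_mul, map_units_inv_eq_neg σ lam hlam, hs]
  ring

end Algebra

/-! ## §2 The chart `Φ : (Fin 9 → F′) ≃ₜ+ ↥𝔲` -/

section Charts

variable {K : Type*} [Field K] [TopologicalSpace K] [IsTopologicalRing K]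
  (σ : K →+* K) (hσ : ∀ x, σ (σ x) = x) [Invertible (2 : K)]
  {J : Matrix (Fin 3) (Fin 3) K} (hJ : J = !![0, 0, 1; 0, 1, 0; 1, 0, 0])
  {F' : Type*} [Field F'] [TopologicalSpace F']
  (ι : F' →+* K) (hι : IsClosedEmbedding ι) (hιr : ∀ x, σ x = x ↔ x ∈ Set.range ι)
  (lam : Kˣ) (hlam : σ lam = -lam)

include hσ hJ hι hιr hlam

/-- **The coordinate chart of `𝔲 = 𝔲(σ, Φ₃)(K)`**: an explicit `Φ : (Fin 9 → F′) ≃ₜ+ ↥𝔲` with entries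
`X₀₀ = ι a₀ + lam·ι a₁`, `X₀₁ = ι a₂ + lam·ι a₃`, `X₁₀ = ι a₄ + lam·ι a₅`, `X₀₂ = lam·ι a₆`, `X₁₁ = lam·ι a₇`, `X₂₀ = lam·ι a₈`, `X₂₂ = −ι a₀ + lam·ι a₁`,
`X₁₂ = −ι a₂ + lam·ι a₃`, `X₂₁ = −ι a₄ + lam·ι a₅`, and the scaling equivariance `Φ (l • a) = ι l • Φ a` (as matrices). [cite: Rogawski1990, §4.9 p. 54]
[cite: PlatonovRapinchuk1994, §2.3.3] -/
theorem exists_coords_lie (𝔲 : AddSubgroup (Matrix (Fin 3) (Fin 3) K)) (h𝔲 : ∀ X, X ∈ 𝔲 ↔ (X.map σ)ᵀ * J + J * X = 0) :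
    ∃ Φ : (Fin 9 → F') ≃ₜ+ ↥𝔲,
      (∀ a : Fin 9 → F',
        ((Φ a : ↥𝔲) : Matrix (Fin 3) (Fin 3) K) 0 0 = ι (a 0) + lam * ι (a 1) ∧
        ((Φ a : ↥𝔲) : Matrix (Fin 3) (Fin 3) K) 0 1 = ι (a 2) + lam * ι (a 3) ∧
        ((Φ a : ↥𝔲) : Matrix (Fin 3) (Fin 3) K) 1 0 = ι (a 4) + lam * ι (a 5) ∧
        ((Φ a : ↥𝔲) : Matrix (Fin 3) (Fin 3) K) 0 2 = lam * ι (a 6) ∧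
        ((Φ a : ↥𝔲) : Matrix (Fin 3) (Fin 3) K) 1 1 = lam * ι (a 7) ∧
        ((Φ a : ↥𝔲) : Matrix (Fin 3) (Fin 3) K) 2 0 = lam * ι (a 8) ∧
        ((Φ a : ↥𝔲) : Matrix (Fin 3) (Fin 3) K) 2 2 = -ι (a 0) + lam * ι (a 1) ∧
        ((Φ a : ↥𝔲) : Matrix (Fin 3) (Fin 3) K) 1 2 = -ι (a 2) + lam * ι (a 3) ∧
        ((Φ a : ↥𝔲) : Matrix (Fin 3) (Fin 3) K) 2 1 = -ι (a 4) + lam * ι (a 5)) ∧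
      (∀ (l : F') (a : Fin 9 → F'), ((Φ (l • a) : ↥𝔲) : Matrix (Fin 3) (Fin 3) K) = ι l • ((Φ a : ↥𝔲) : Matrix (Fin 3) (Fin 3) K)) := by
  subst hJ
  obtain ⟨g, hg, hgc⟩ := exists_continuousOn_leftInverse ι hι
  have hισ : ∀ a, σ (ι a) = ι a := fun a => (hιr _).2 ⟨a, rfl⟩
  have hfix : ∀ x : K, σ x = x → ι (g x) = x := fun x hx => by
    obtain ⟨a, rfl⟩ := (hιr x).1 hx; rw [hg]
  have hιc : Continuous ι := hι.continuous
  -- the forward matrix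
  set M : (Fin 9 → F') → Matrix (Fin 3) (Fin 3) K := fun a =>
    !![ι (a 0) + lam * ι (a 1), ι (a 2) + lam * ι (a 3), lam * ι (a 6);
       ι (a 4) + lam * ι (a 5), lam * ι (a 7), -ι (a 2) + lam * ι (a 3);
       lam * ι (a 8), -ι (a 4) + lam * ι (a 5), -ι (a 0) + lam * ι (a 1)] with hM
  have hMmem : ∀ a, M a ∈ 𝔲 := fun a => by
    rw [h𝔲, lie_eq_iff]
    simp only [hM, Matrix.of_apply, Matrix.cons_val', Matrix.cons_val_zero, Matrix.cons_val_one, Matrix.cons_val_two, Matrix.head_cons,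
      Matrix.tail_cons, Matrix.empty_val', Matrix.cons_val_fin_one, Matrix.head_fin_const, map_add, map_neg, map_mul, hισ, hlam]
    refine ⟨⟨by ring, by ring, by ring⟩, ⟨by ring, by ring, by ring⟩, ⟨by ring, by ring, by ring⟩⟩
  -- the backward coordinates
  set N : Matrix (Fin 3) (Fin 3) K → (Fin 9 → F') := fun X =>
    ![g ((X 0 0 - X 2 2) * ⅟(2 : K)), g ((X 0 0 + X 2 2) * ⅟(2 : K) * ((lam⁻¹ : Kˣ) : K)),
      g ((X 0 1 - X 1 2) * ⅟(2 : K)), g ((X 0 1 + X 1 2) * ⅟(2 : K) * ((lam⁻¹ : Kˣ) : K)),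
      g ((X 1 0 - X 2 1) * ⅟(2 : K)), g ((X 1 0 + X 2 1) * ⅟(2 : K) * ((lam⁻¹ : Kˣ) : K)),
      g (X 0 2 * ((lam⁻¹ : Kˣ) : K)), g (X 1 1 * ((lam⁻¹ : Kˣ) : K)), g (X 2 0 * ((lam⁻¹ : Kˣ) : K))] with hN
  -- left inverse
  have hNM : ∀ a, N (M a) = a := fun a => by
    funext k
    fin_cases k <;>
      simp only [hN, hM, Matrix.of_apply, Matrix.cons_val', Matrix.cons_val_zero, Matrix.cons_val_one, Matrix.cons_val_two, Matrix.head_cons,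
        Matrix.tail_cons, Matrix.empty_val', Matrix.cons_val_fin_one, Matrix.head_fin_const, Fin.isValue, Fin.mk_zero, Fin.mk_one, Fin.reduceFinMk,
        Matrix.cons_val, pair_fst, pair_snd, skew_coord, hg]
  -- right inverse on `𝔲`
  have hMN : ∀ X ∈ 𝔲, M (N X) = X := fun X hX => by
    rw [h𝔲, lie_eq_iff] at hX
    obtain ⟨⟨h00, h01, h02⟩, ⟨h10, h11, h12⟩, ⟨h20, h21, h22⟩⟩ := hX
    have f0 := hfix _ (pair_fst_fixed σ hσ h02)
    have f1 := hfix _ (pair_snd_fixed σ hσ lam hlam h02)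
    have f2 := hfix _ (pair_fst_fixed σ hσ h12)
    have f3 := hfix _ (pair_snd_fixed σ hσ lam hlam h12)
    have f4 := hfix _ (pair_fst_fixed σ hσ h01)
    have f5 := hfix _ (pair_snd_fixed σ hσ lam hlam h01)
    have f6 := hfix _ (skew_fixed σ lam hlam h22)
    have f7 := hfix _ (skew_fixed σ lam hlam h11)
    have f8 := hfix _ (skew_fixed σ lam hlam h00)
    ext i j
    fin_cases i <;> fin_cases j <;>
      simp only [hM, hN, Matrix.of_apply, Matrix.cons_val', Matrix.cons_val_zero, Matrix.cons_val_one, Matrix.cons_val_two, Matrix.head_cons,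
        Matrix.tail_cons, Matrix.empty_val', Matrix.cons_val_fin_one, Matrix.head_fin_const, Fin.isValue, Fin.mk_zero, Fin.mk_one, Fin.reduceFinMk,
        Matrix.cons_val, f0, f1, f2, f3, f4, f5, f6, f7, f8] <;>
      first
        | exact pair_recombine_fst lam _ _
        | exact pair_recombine_snd lam _ _
        | exact skew_recombine lam _
  -- continuity
  have hMc : Continuous M := by
    refine continuous_matrix fun i j => ?_
    fin_cases i <;> fin_cases j <;>
      simp only [hM, Matrix.of_apply, Matrix.cons_val', Matrix.cons_val_zero, Matrix.cons_val_one, Matrix.cons_val_two, Matrix.head_cons,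
        Matrix.tail_cons, Matrix.empty_val', Matrix.cons_val_fin_one, Matrix.head_fin_const, Fin.isValue, Fin.mk_zero, Fin.mk_one, Fin.reduceFinMk] <;>
      fun_prop
  have hNc : Continuous fun X : ↥𝔲 => N (X : Matrix (Fin 3) (Fin 3) K) := by
    refine continuous_pi fun k => ?_
    have hent : ∀ i j, Continuous fun X : ↥𝔲 => (X : Matrix (Fin 3) (Fin 3) K) i j :=
      fun i j => (continuous_apply j).comp ((continuous_apply i).comp continuous_subtype_val)
    have hmem : ∀ X : ↥𝔲, (((X : Matrix (Fin 3) (Fin 3) K).map σ)ᵀ * !![(0 : K), 0, 1; 0, 1, 0; 1, 0, 0] +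
        !![(0 : K), 0, 1; 0, 1, 0; 1, 0, 0] * (X : Matrix (Fin 3) (Fin 3) K) = 0) := fun X => (h𝔲 _).1 X.2
    fin_cases k <;>
      simp only [hN, Matrix.cons_val_zero, Matrix.cons_val_one, Matrix.cons_val_two, Matrix.head_cons, Matrix.tail_cons,
        Fin.isValue, Fin.mk_zero, Fin.mk_one, Fin.reduceFinMk, Matrix.cons_val]
    · exact hgc.comp_continuous ((hent 0 0).sub (hent 2 2) |>.mul continuous_const) fun X =>
        (hιr _).1 (pair_fst_fixed σ hσ ((lie_eq_iff σ _).1 (hmem X)).1.2.2)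
    · exact hgc.comp_continuous (((hent 0 0).add (hent 2 2) |>.mul continuous_const).mul continuous_const) fun X =>
        (hιr _).1 (pair_snd_fixed σ hσ lam hlam ((lie_eq_iff σ _).1 (hmem X)).1.2.2)
    · exact hgc.comp_continuous ((hent 0 1).sub (hent 1 2) |>.mul continuous_const) fun X =>
        (hιr _).1 (pair_fst_fixed σ hσ ((lie_eq_iff σ _).1 (hmem X)).2.1.2.2)
    · exact hgc.comp_continuous (((hent 0 1).add (hent 1 2) |>.mul continuous_const).mul continuous_const) fun X =>
        (hιr _).1 (pair_snd_fixed σ hσ lam hlam ((lie_eq_iff σ _).1 (hmem X)).2.1.2.2)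
    · exact hgc.comp_continuous ((hent 1 0).sub (hent 2 1) |>.mul continuous_const) fun X =>
        (hιr _).1 (pair_fst_fixed σ hσ ((lie_eq_iff σ _).1 (hmem X)).1.2.1)
    · exact hgc.comp_continuous (((hent 1 0).add (hent 2 1) |>.mul continuous_const).mul continuous_const) fun X =>
        (hιr _).1 (pair_snd_fixed σ hσ lam hlam ((lie_eq_iff σ _).1 (hmem X)).1.2.1)
    · exact hgc.comp_continuous ((hent 0 2).mul continuous_const) fun X =>
        (hιr _).1 (skew_fixed σ lam hlam ((lie_eq_iff σ _).1 (hmem X)).2.2.2.2)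
    · exact hgc.comp_continuous ((hent 1 1).mul continuous_const) fun X =>
        (hιr _).1 (skew_fixed σ lam hlam ((lie_eq_iff σ _).1 (hmem X)).2.1.2.1)
    · exact hgc.comp_continuous ((hent 2 0).mul continuous_const) fun X =>
        (hιr _).1 (skew_fixed σ lam hlam ((lie_eq_iff σ _).1 (hmem X)).1.1)
  -- additivity
  have hMadd : ∀ a b, M (a + b) = M a + M b := fun a b => by
    ext i j
    fin_cases i <;> fin_cases j <;>
      simp only [hM, Matrix.add_apply, Pi.add_apply, Matrix.of_apply, Matrix.cons_val', Matrix.cons_val_zero, Matrix.cons_val_one, Matrix.cons_val_two,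
        Matrix.head_cons, Matrix.tail_cons, Matrix.empty_val', Matrix.cons_val_fin_one, Matrix.head_fin_const, Fin.isValue, Fin.mk_zero, Fin.mk_one,
        Fin.reduceFinMk, map_add] <;> ring
  -- assemble
  let Φ : (Fin 9 → F') ≃ₜ+ ↥𝔲 :=
    { toFun := fun a => ⟨M a, hMmem a⟩
      invFun := fun X => N (X : Matrix (Fin 3) (Fin 3) K)
      left_inv := fun a => hNM a
      right_inv := fun X => Subtype.ext (hMN X.1 X.2)
      map_add' := fun a b => Subtype.ext (hMadd a b)
      continuous_toFun := hMc.subtype_mk _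
      continuous_invFun := hNc }
  have hΦ : ∀ a, ((Φ a : ↥𝔲) : Matrix (Fin 3) (Fin 3) K) = M a := fun a => rfl
  refine ⟨Φ, fun a => ?_, fun l a => ?_⟩
  · simp only [hΦ, hM, Matrix.of_apply, Matrix.cons_val', Matrix.cons_val_zero, Matrix.cons_val_one, Matrix.cons_val_two, Matrix.head_cons,
      Matrix.tail_cons, Matrix.empty_val', Matrix.cons_val_fin_one, Matrix.head_fin_const, and_self]
  · rw [hΦ, hΦ]
    ext i j
    fin_cases i <;> fin_cases j <;>
      simp only [hM, Matrix.smul_apply, Pi.smul_apply, smul_eq_mul, Matrix.of_apply, Matrix.cons_val', Matrix.cons_val_zero, Matrix.cons_val_one,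
        Matrix.cons_val_two, Matrix.head_cons, Matrix.tail_cons, Matrix.empty_val', Matrix.cons_val_fin_one, Matrix.head_fin_const, Fin.isValue,
        Fin.mk_zero, Fin.mk_one, Fin.reduceFinMk, map_mul] <;> ring

end Charts

end Summit.HodgeConjecture.HodgeConjecture.Cruxes.H413.F0P3cStCharTSHCDCoordinates
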